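import Summits.BirchSwinnertonDyer.BirchSwinnertonDyer.Theorems.ErratumRoadFiveNonSurjCornerTamagawaCarriers
import HarnessLib

/-!
# Route `ErratumRoadFive` (rung K2), crux `NonSurjCorner` (item stmt-BirchSwinnertonDyer-19065), with reach to
# crux `CornerAtThree` (item 19111): THE CARRIERS OF `t = ord_p ∏ c_v` AT ANY PRIME — `ord_p Tam = Σ_v ord_p c_v`;
# MULTI-carrier ⟺ two distinct places with `p ∣ c_v` (every prime, every `E/ℚ`); at `p ≥ 3` a non-split place
# is a carrier iff `c_v = p` (so only `p = 3`: Kodaira IV ∕ IV*); on the `p = 3` corner the carriers are the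
# split multiplicative places and the places with `c_v = 3`
# (cell `bsd-stepL`, seat `bsd-stepL-corner5-p2` g4, WIDTH-LEVER lane B; `--supports stmt-BirchSwinnertonDyer-19065
# --as helper`; courtesy reach to 19111's `Lines/inert.lean` stubs `stub_upper3_jetchevMaxMono` ∕ `stub_upper3_residualMulti`)

WHY THIS FILE. `…NonSurjCornerTamagawaCarriers` (p557941) characterised the mono ∕ multi-carrier cut of 19947
(`p ∈ {5,7}`) by split multiplicative places. The same cut is registered on crux 19111 at `p = 3`
(`stub_upper3_jetchevMaxMono`: «`∃ v, ord_3 Tam ≤ ord_3 c_v`»; `stub_upper3_residualMulti`: «`∀ v, ord_3 c_v <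
ord_3 Tam`»), where additive places of Kodaira type IV ∕ IV* may have `c_v = 3`. This file gives the prime-free
bookkeeping and the `p = 3` reading:

* `padicValNat_tamagawaProduct_eq_sum_padicValNat_tamagawaNumberAt` — `ord_p Tam(E) = Σ_v ord_p c_v` (any `p`);
  `padicValNat_tamagawaNumberAt_eq_of_unique_dvd` — a unique place with `p ∣ c_v` carries all of `t`;
* **`forall_padicValNat_tamagawaNumberAt_lt_iff_exists_two_dvd`** — for EVERY prime and EVERY `E/ℚ`:
  «`∀ v, ord_p c_v < ord_p Tam`» ⟺ two distinct places with `p ∣ c_v`; and its negation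
  `exists_padicValNat_le_tamagawaNumberAt_iff_not_exists_two_dvd` (the MONO hypothesis);
* `dvd_tamagawaNumberAt_iff_eq_of_not_split` (`p ≥ 3`: a non-split place is a carrier iff `c_v = p`),
  `not_dvd_tamagawaNumberAt_of_not_split` (`p ≥ 5`: never), `dvd_tamagawaNumberAt_iff_dvd_ordMinimalDiscriminant_of_split`;
* image-level (`Mult ∧ Irr ∧ ¬Surj`, any odd `p` — covers 19111's `ClassX11b W 3 ∧ ¬ Surj W 3`):
  `dvd_tamagawaNumberAt_of_split_of_mult_of_irr_of_not_surj` (split places are carriers),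
  `dvd_tamagawaNumberAt_iff_split_or_eq_of_mult_of_irr_of_not_surj` (`p ≥ 3`: carrier ⟺ split ∨ `c_v = p`);
* **`CornerAtThree.forall_lt_iff_exists_two`** — on the `p = 3` corner: the hypothesis of `stub_upper3_residualMulti`
  ⟺ two distinct places each split multiplicative or with `c_v = 3`;
  `NonSurjCorner.forall_lt_iff_exists_two_split` — the `p ≥ 5` corner form without the `p ∣ Tam` conjunct.

HONEST FRAMING: structure theorems (0 definitions, 0 named facts, 0 sorry); nothing here proves a crux, a registered
stub, or BSD for any class; no census number moves (T7). References: [SilvermanATAEC1994] Cor. IV.9.2 (d), Table 4.1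
(types IV, IV*: `c_v ∈ {1, 3}`); [SilvermanAEC2009] C.16; [Jetchev2008] §1; tree: `Theorems/ErratumRoadFiveNonSurjCorner
{TamagawaExponent,TamagawaCarriers}`, `Cruxes/CornerAtThree/Lines/inert.lean`, `Cruxes/NonSurjCornerKolyJ/Lines/birth.lean`.
-/

set_option linter.dupNamespace false -- `Summit.BirchSwinnertonDyer.BirchSwinnertonDyer` (summit = problem), tree-wide
set_option autoImplicit false

noncomputable section

open scoped Classical NumberField
open IsDedekindDomain Field WeierstrassCurve

namespace Summit.BirchSwinnertonDyer.BirchSwinnertonDyer.Theorems.CornerLocal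

open WeierstrassCurve NumberField Rat.HeightOneSpectrum
  Literature.NumberTheory.EllipticCurves
  Literature.NumberTheory.EllipticCurves.Rank1Residual
  Summit.BirchSwinnertonDyer.Rank1Residual

variable (W : WeierstrassCurve ℚ) [W.IsElliptic] (p : ℕ) [hp : Fact p.Prime]

/-! ### Carriers at ANY prime: `ord_p Tam = Σ_v ord_p c_v`; multi-carrier ⟺ two places with `p ∣ c_v`;
at `p ≥ 3` a non-split place is a carrier iff `c_v = p` (so only `p = 3`, Kodaira IV ∕ IV*) -/

section AnyPrime

/-- **`ord_p Tam(E) = Σ_v ord_p c_v`** over any finite set of places containing the bad ones (any prime `p`,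
any `E/ℚ`): `Tam(E)` is the finite product of the `c_v`, all non-zero. [cite: SilvermanAEC2009, C.16 (Tamagawa numbers)] -/
theorem padicValNat_tamagawaProduct_eq_sum_padicValNat_tamagawaNumberAt
    (S : Finset (HeightOneSpectrum (𝓞 ℚ))) (hS : ∀ v, W.ordMinimalDiscriminant v ≠ 0 → v ∈ S) :
    padicValNat p W.tamagawaProduct = ∑ v ∈ S, padicValNat p (W.tamagawaNumberAt v) := by
  have hprod : ∀ (T : Finset (HeightOneSpectrum (𝓞 ℚ))) (f : HeightOneSpectrum (𝓞 ℚ) → ℕ),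
      (∀ v ∈ T, f v ≠ 0) → padicValNat p (∏ v ∈ T, f v) = ∑ v ∈ T, padicValNat p (f v) := by
    intro T f hf
    induction T using Finset.cons_induction with
    | empty => simp
    | cons a s ha ih =>
      rw [Finset.prod_cons, Finset.sum_cons, padicValNat.mul (hf a (Finset.mem_cons_self a s))
        (Finset.prod_ne_zero_iff.mpr fun i hi => hf i (Finset.mem_cons_of_mem hi)),
        ih fun i hi => hf i (Finset.mem_cons_of_mem hi)]
  rw [tamagawaProduct_eq_prod W S hS, hprod S _ fun v _ => W.localTamagawaNumber_baseChange_ne_zero v]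

/-- **A unique carrier carries all of `t`** (any prime, any `E/ℚ`): if `p ∣ c_{v₀}` and `p ∤ c_v` for every
other place `v`, then `ord_p c_{v₀} = ord_p Tam(E)`. [cite: SilvermanAEC2009, C.16 (Tamagawa numbers)] -/
theorem padicValNat_tamagawaNumberAt_eq_of_unique_dvd {v₀ : HeightOneSpectrum (𝓞 ℚ)}
    (huniq : ∀ v : HeightOneSpectrum (𝓞 ℚ), p ∣ W.tamagawaNumberAt v → v = v₀) :
    padicValNat p (W.tamagawaNumberAt v₀) = padicValNat p W.tamagawaProduct := by
  obtain ⟨S, hS⟩ := exists_finset_bad W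
  rw [padicValNat_tamagawaProduct_eq_sum_padicValNat_tamagawaNumberAt W p (insert v₀ S)
      fun w hw => Finset.mem_insert_of_mem ((hS w).mp hw),
    Finset.sum_eq_single_of_mem v₀ (Finset.mem_insert_self v₀ S) fun v _ hv => ?_]
  exact padicValNat.eq_zero_of_not_dvd fun h => hv (huniq v h)

/-- **MULTI-CARRIER ⟺ TWO DISTINCT PLACES WITH `p ∣ c_v`** — for EVERY prime `p` and EVERY `E/ℚ`: the
hypothesis «`ord_p c_v < ord_p Tam(E)` for every place `v`» (registered stubs `stub_kolyJ_multi` of 19947 at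
`p ∈ {5,7}` and `stub_upper3_residualMulti` of 19111 at `p = 3`, up to their other binders) holds iff there are
two distinct places `v₁ ≠ v₂` with `p ∣ c_{v₁}` and `p ∣ c_{v₂}`. (⇒) `t ≥ 1` (the hypothesis at any `v` gives
`0 < t`), so some `c_{v₁}` is divisible by `p` (`t = Σ_v ord_p c_v`); were it the only one it would carry all of
`t`. (⇐) two distinct carriers contribute additively (`padicValNat_tamagawaNumberAt_add_le_of_ne`), each `≥ 1`.
[cite: SilvermanAEC2009, C.16 (Tamagawa numbers)] [cite: Jetchev2008, §1 (the exponents ord_p c_q)] -/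
theorem forall_padicValNat_tamagawaNumberAt_lt_iff_exists_two_dvd :
    (∀ v : HeightOneSpectrum (𝓞 ℚ), padicValNat p (W.tamagawaNumberAt v) < padicValNat p W.tamagawaProduct) ↔
      ∃ v₁ v₂ : HeightOneSpectrum (𝓞 ℚ), v₁ ≠ v₂ ∧ p ∣ W.tamagawaNumberAt v₁ ∧ p ∣ W.tamagawaNumberAt v₂ := by
  constructor
  · intro hlt
    obtain ⟨S, hS⟩ := exists_finset_bad W
    -- some carrier exists: `t = Σ ord_p c_v > 0`
    have ht : 0 < padicValNat p W.tamagawaProduct := by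
      set v₂ : HeightOneSpectrum (𝓞 ℚ) := (primesEquiv (R := 𝓞 ℚ)).symm ⟨2, Nat.prime_two⟩
      exact lt_of_le_of_lt (Nat.zero_le _) (hlt v₂)
    have hex : ∃ v₁ : HeightOneSpectrum (𝓞 ℚ), p ∣ W.tamagawaNumberAt v₁ := by
      by_contra hne
      push Not at hne
      rw [padicValNat_tamagawaProduct_eq_sum_padicValNat_tamagawaNumberAt W p S fun w hw => (hS w).mp hw,
        Finset.sum_eq_zero fun v _ => padicValNat.eq_zero_of_not_dvd (hne v)] at ht
      exact lt_irrefl 0 ht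
    obtain ⟨v₁, hv₁⟩ := hex
    by_contra hno
    push Not at hno
    have huniq : ∀ v : HeightOneSpectrum (𝓞 ℚ), p ∣ W.tamagawaNumberAt v → v = v₁ := fun v hv => by
      by_contra h
      exact hno v₁ v (Ne.symm h) hv₁ hv
    exact (hlt v₁).ne (padicValNat_tamagawaNumberAt_eq_of_unique_dvd W p huniq)
  · rintro ⟨v₁, v₂, hne, hd₁, hd₂⟩ v
    have h₁ : 1 ≤ padicValNat p (W.tamagawaNumberAt v₁) := by
      rw [← padicValNat_dvd_iff_le (W.localTamagawaNumber_baseChange_ne_zero v₁), pow_one]; exact hd₁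
    have h₂ : 1 ≤ padicValNat p (W.tamagawaNumberAt v₂) := by
      rw [← padicValNat_dvd_iff_le (W.localTamagawaNumber_baseChange_ne_zero v₂), pow_one]; exact hd₂
    by_cases hv : v = v₁
    · subst hv
      have := padicValNat_tamagawaNumberAt_add_le_of_ne W p hne
      omega
    · have := padicValNat_tamagawaNumberAt_add_le_of_ne W p hv
      omega

/-- **MONO-CARRIER form** (any prime, any `E/ℚ`): the hypothesis «some place `v` has `ord_p Tam(E) ≤ ord_p c_v`»
(registered stub `stub_upper3_jetchevMaxMono` of 19111; the skeleton's case split of 19947) holds iff there are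
NOT two distinct places with `p ∣ c_v`. [cite: SilvermanAEC2009, C.16 (Tamagawa numbers)] -/
theorem exists_padicValNat_le_tamagawaNumberAt_iff_not_exists_two_dvd :
    (∃ v : HeightOneSpectrum (𝓞 ℚ), padicValNat p W.tamagawaProduct ≤ padicValNat p (W.tamagawaNumberAt v)) ↔
      ¬ ∃ v₁ v₂ : HeightOneSpectrum (𝓞 ℚ), v₁ ≠ v₂ ∧ p ∣ W.tamagawaNumberAt v₁ ∧ p ∣ W.tamagawaNumberAt v₂ := by
  rw [← forall_padicValNat_tamagawaNumberAt_lt_iff_exists_two_dvd W p]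
  push Not
  rfl

omit hp in
/-- **At `p ≥ 3`, a place which is NOT split multiplicative is a carrier iff `c_v = p`** (`1 ≤ c_v ≤ 4 < 2p`);
so for `p ≥ 5` never, and for `p = 3` exactly the places with `c_v = 3` (Kodaira types IV, IV* with rational
components). [cite: SilvermanATAEC1994, Cor. IV.9.2 (d) and Table 4.1] -/
theorem dvd_tamagawaNumberAt_iff_eq_of_not_split (hp3 : 3 ≤ p) {v : HeightOneSpectrum (𝓞 ℚ)}
    (hns : ¬ W.HasSplitMultiplicativeReductionAt v) :
    p ∣ W.tamagawaNumberAt v ↔ W.tamagawaNumberAt v = p := by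
  have h1 : 1 ≤ W.tamagawaNumberAt v := one_le_localTamagawaNumber W v
  have h4 : W.tamagawaNumberAt v ≤ 4 := localTamagawaNumber_le_four_of_not_split W v hns
  refine ⟨fun ⟨k, hk⟩ => ?_, fun h => h ▸ dvd_rfl⟩
  have hk1 : k = 1 := by
    rcases Nat.lt_or_ge k 2 with hlt | hge
    · interval_cases k
      · omega
      · rfl
    · nlinarith
  rw [hk, hk1, mul_one]

omit hp in
/-- For `p ≥ 5` a non-split place is never a carrier. [cite: SilvermanATAEC1994, Cor. IV.9.2 (d)] -/
theorem not_dvd_tamagawaNumberAt_of_not_split (hp5 : 5 ≤ p) {v : HeightOneSpectrum (𝓞 ℚ)}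
    (hns : ¬ W.HasSplitMultiplicativeReductionAt v) : ¬ p ∣ W.tamagawaNumberAt v := by
  rw [dvd_tamagawaNumberAt_iff_eq_of_not_split W p (by omega) hns]
  have h4 : W.tamagawaNumberAt v ≤ 4 := localTamagawaNumber_le_four_of_not_split W v hns
  omega

omit hp in
/-- At a split multiplicative place, `p ∣ c_v ⟺ p ∣ ord_v(Δ_min)` (any `p`). [cite: SilvermanATAEC1994, Cor. IV.9.2 (d)] -/
theorem dvd_tamagawaNumberAt_iff_dvd_ordMinimalDiscriminant_of_split {v : HeightOneSpectrum (𝓞 ℚ)}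
    (hs : W.HasSplitMultiplicativeReductionAt v) :
    p ∣ W.tamagawaNumberAt v ↔ p ∣ W.ordMinimalDiscriminant v := by
  rw [tamagawaNumberAt_eq_ordMinimalDiscriminant_of_split W hs]

variable [W.IsGloballyMinimal]

/-- **Image-level form (any ODD `p`, `Mult ∧ Irr ∧ ¬Surj`): every split multiplicative place is a carrier,
`p ∣ c_v`** — covers the `p = 3` corner of item 19111 (`ClassX11b W 3 ∧ ¬ Surj W 3`) as well as `p ∈ {5,7}`
and the X11a twins. [cite: SilvermanATAEC1994, Cor. IV.9.2 (d)] [cite: Serre1972, §2.4 Prop. 15, §5.4] -/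
theorem dvd_tamagawaNumberAt_of_split_of_mult_of_irr_of_not_surj (hp2 : p ≠ 2) (hmult : Mult W p)
    (hirr : Irr W p) (hns : ¬ Surj W p) {v : HeightOneSpectrum (𝓞 ℚ)}
    (hs : W.HasSplitMultiplicativeReductionAt v) : p ∣ W.tamagawaNumberAt v :=
  (dvd_tamagawaNumberAt_iff_dvd_ordMinimalDiscriminant_of_split W p hs).mpr
    (dvd_ordMinimalDiscriminant_of_mult_of_irr_of_not_surj W p hp2 hmult hirr hns
      hs.hasMultiplicativeReductionAt)

/-- **The carriers at an odd prime `p ≥ 3`, image-level** (`Mult ∧ Irr ∧ ¬Surj`, e.g. the `p = 3` corner of 19111):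
`p ∣ c_v ⟺ v` is split multiplicative OR `c_v = p` (the latter possible only at `p = 3`: an additive place of
Kodaira type IV ∕ IV* with `c_v = 3`). [cite: SilvermanATAEC1994, Cor. IV.9.2 (d) and Table 4.1] -/
theorem dvd_tamagawaNumberAt_iff_split_or_eq_of_mult_of_irr_of_not_surj (hp3 : 3 ≤ p) (hmult : Mult W p)
    (hirr : Irr W p) (hns : ¬ Surj W p) (v : HeightOneSpectrum (𝓞 ℚ)) :
    p ∣ W.tamagawaNumberAt v ↔ W.HasSplitMultiplicativeReductionAt v ∨ W.tamagawaNumberAt v = p := by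
  by_cases hs : W.HasSplitMultiplicativeReductionAt v
  · exact ⟨fun _ => Or.inl hs, fun _ =>
      dvd_tamagawaNumberAt_of_split_of_mult_of_irr_of_not_surj W p (by omega) hmult hirr hns hs⟩
  · rw [dvd_tamagawaNumberAt_iff_eq_of_not_split W p hp3 hs]
    exact ⟨Or.inr, fun h => h.resolve_left hs⟩

/-- **The `p = 3` corner of item 19111 (`ClassX11b W 3 ∧ ¬ Surj W 3`): multi-carrier ⟺ two distinct places each
split multiplicative or with `c_v = 3`.** The hypothesis of `stub_upper3_residualMulti` («`ord_3 c_v < ord_3 Tam`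
for every `v`») in reduction-type terms; the complement (`stub_upper3_jetchevMaxMono`'s «`∃ v, ord_3 Tam ≤ ord_3 c_v`»)
is «at most one such place». [cite: SilvermanATAEC1994, Cor. IV.9.2 (d) and Table 4.1] [cite: Jetchev2008, §1] -/
theorem CornerAtThree.forall_lt_iff_exists_two [Fact (Nat.Prime 3)] (hX : ClassX11b W 3) (hns : ¬ Surj W 3) :
    (∀ v : HeightOneSpectrum (𝓞 ℚ), padicValNat 3 (W.tamagawaNumberAt v) < padicValNat 3 W.tamagawaProduct) ↔
      ∃ v₁ v₂ : HeightOneSpectrum (𝓞 ℚ), v₁ ≠ v₂ ∧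
        (W.HasSplitMultiplicativeReductionAt v₁ ∨ W.tamagawaNumberAt v₁ = 3) ∧
        (W.HasSplitMultiplicativeReductionAt v₂ ∨ W.tamagawaNumberAt v₂ = 3) := by
  rw [forall_padicValNat_tamagawaNumberAt_lt_iff_exists_two_dvd W 3]
  simp only [dvd_tamagawaNumberAt_iff_split_or_eq_of_mult_of_irr_of_not_surj W 3 le_rfl hX.2.2.1 hX.2.2.2 hns]

/-- **The `p ∈ {5,7}` corner (19065 ∕ 19947), any-prime form recovered**: multi-carrier ⟺ two distinct split
multiplicative places (non-split places are never carriers at `p ≥ 5`) — `NonSurjCorner.multiCarrier_iff_two_split`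
of `…TamagawaCarriers` without the `p ∣ Tam` conjunct. [cite: SilvermanATAEC1994, Cor. IV.9.2 (d) and Table 4.1] -/
theorem NonSurjCorner.forall_lt_iff_exists_two_split (hX : ClassX11b W p) (hns : ¬ Surj W p) (hp5 : 5 ≤ p) :
    (∀ v : HeightOneSpectrum (𝓞 ℚ), padicValNat p (W.tamagawaNumberAt v) < padicValNat p W.tamagawaProduct) ↔
      ∃ v₁ v₂ : HeightOneSpectrum (𝓞 ℚ), v₁ ≠ v₂ ∧
        W.HasSplitMultiplicativeReductionAt v₁ ∧ W.HasSplitMultiplicativeReductionAt v₂ := by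
  rw [forall_padicValNat_tamagawaNumberAt_lt_iff_exists_two_dvd W p]
  simp only [NonSurjCorner.dvd_tamagawaNumberAt_iff_split W p hX hns hp5]

end AnyPrime

end Summit.BirchSwinnertonDyer.BirchSwinnertonDyer.Theorems.CornerLocal

end
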